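import Summits.QuantumFields.BalabanUV.Beta.SymTablesOf
import Summits.QuantumFields.BalabanUV.Beta.CompositeVertexKernelBoundsTwoSym
import Summits.QuantumFields.BalabanUV.Beta.CompositeHessianTable
import Summits.QuantumFields.BalabanUV.Beta.CompositeMixedTableBounds
import Summits.QuantumFields.BalabanUV.Beta.ChartStepJets
import Summits.QuantumFields.BalabanUV.Beta.CompositeCorrectorDress

/-!
# `BalabanUV.Beta.CompositeOneShotJets` — row D1 ∕ (C1), file F6d part 1b: THE COMPOSITE TABLE RECORD `tabsComp` AND THE RAW COMPOSITE ONE-SHOT JETS `𝒥N`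
# under (β1) + (D-b) + (A) (SPEC S-an2-g52-1 §1) — the (III′) literal's LEVEL-0 member AT BLOCKING `L^m` AT THE COMPOSITE CHART, over the five composite
# (0.4)-symmetrised tables packed by F6b's `tabsOf`

WHAT.  At one root `r ∈ box (d+1) L` (the (β1) tower: `r := ctrOff`, every level) and depth `m`:
* §1 [our object] the five composite SYM tables at blocking `L^m` — `compV r L m := compVhS` (F3, sym bricks), `compH r L m := compHessFF` (F6a), `compB r L m := atw ∘ compVh2S`
  over `(symLinKerAt, symVhKerAt, symVh2KerSymAt)` (F5 ∕ F5c §4 «SymSym», packed ANTI-TWIN exactly as the record's `symVh₂SAn1 = atw (½ • (symVh₂SAt + swap))`), `compMix r L m := compMixFF`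
  (F6c, sym bricks) — and their eight letters in `tabsOf`'s hypothesis shapes (F3b∕F6a∕F5c∕F6c-2 (S) instantiations + `biLoc_atw ∕ atw_shiftK`); [our object] **`tabsComp r L m cM : SymTables d (L^m)
  := tabsOf (L^m) (compV …) (compH …) cM (compB …) (compMix …) ⟨letters⟩`**; the ANCHORS at `m = 1`: `compV r L 1 = symVhSAt (toSite r) d L` (F3b), `compH r L 1 = symHessFFAt (toSite r) L` (F6a),
  **`compB r L 1 = symVh₂SAn1 d L` at `r = ctrOff`** (F5c §4 + `rfl`), `compMix r L 1 = symMixFFAt (toSite r) L` (F6c-2 §4) — so `tabsComp ctrOff L 1 cM` has the (0.4) record's five tables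
  (`SymTablesOf.symTablesAn1S2_eq_tabsOf`).
* §2 [our object] the composite chart's letters as a CONSTANT family: `decays_compChart`, `shiftK_compChart` (K-U3d's `spr_psiK ∕ shiftK_psiK` + an2's `spr∕shiftK_coDressKBmAt` + `decays∕shiftK_KInv`
  — `CompositeOneShotChart.spr_compositeA ∕ shiftK_compositeA`'s proofs at F6e's `compChart`, NOT imported from that olean-less module); [our object] **`JN hL hr m s hs cM cE cVH cΛ cE₂ cB T : JetData d (L^m)
  := JsChart0Of (fun _ => compChart r L m s (L^m)) (decays) (tabsComp r L m cM) cE cVH cΛ cE₂ cB T 0`** — THE RAW COMPOSITE JETS (F6d-1a's packaging at the constant chart family); `JN_S ∕ JN_W` (`rfl`: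
  `S = S0NOf d (L^m) (compV) (compH) cE cVH cΛ` — the Λ word's kernel is `KInv (L^m)`, Q-an2-g52-1 (a); `W = WrecOf … (fun _ => compChart …) … 0`).
WHAT THIS IS NOT: not `JcComp` ∕ `TshotOf_JcComp_succ_succ` (part 2: `pullJ` of `JN` + the piecewise family + #28's `hJc1`), not the sym-corrector instance (`psiK` here; `psiKSym` when K-U3d lands it),
not the units pin P-F6-2 (the pins are PARAMETERS `cE cVH cΛ cE₂ cB T`); nothing of Bałaban's asserted, valued or discharged; 0 estimates; 0∕4 row-D1 binders; NOT (C1) complete, NOT D1,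
NEVER «G-an2-4 closed», NOT BetaPertH, NOT continuum, NOT Clay.  [folklore] packaging BY NAME; [our object — bookkeeping] six definitions (`compV compH compB compMix tabsComp JN`).

HONEST DEPENDENCY (page 1, mandatory): continuum YM on T⁴ ⇐ BetaPertH ∧ nine spine estimates (0/9 proved); BetaPertH ⇐ (D1) ∧ (D4) ∧ CAP+tail;
G-an2-4 gates asym, D1 and NE2/3/4.  Row D1 ∕ (C1) OWNER an2, gen 52, 2026-08-24.  No existing file touched.
-/

noncomputable section

namespace Summit.QuantumFields.BalabanUV.Beta.CompositeOneShotJets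

open Literature.MathematicalPhysics.QuantumFieldTheory
open Literature.MathematicalPhysics.QuantumFieldTheory.Balaban1983to89
open Literature.MathematicalPhysics.QuantumFieldTheory.Balaban1983to89.Beta
open ExpKernelCalculus (MKer Decays BiLoc VertexFamily comp shiftK comp_shiftK)
open AffineAveraging (Site box toSite)
open AveragingContoursRooted (ctr ctrOff ctrOff_mem_box)
open OneStepResolventKernel (Fib KInv LocStencil JetData decays_KInv shiftK_KInv)
open BalabanCompositeJets (LocStencil₂)
open SecondOrderResponse (LocStencilFM)
open Summit.QuantumFields.BalabanUV.Beta.TameKernelCalculus (Spr trK Spr.trK)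
open Summit.QuantumFields.BalabanUV.Beta.ChartConjugationRelative (spr_comp)
open Summit.QuantumFields.BalabanUV.Beta.AxialDressingRooted (coDressKBmAt spr_coDressKBmAt shiftK_coDressKBmAt trK_shiftK one_le_of_neZero)
open Summit.QuantumFields.BalabanUV.Beta.SecondOrderSocketIdentification (atw)
open Summit.QuantumFields.BalabanUV.Beta.SecondOrderTableLawEnd (biLoc_atw atw_shiftK)
open Summit.QuantumFields.BalabanUV.Beta.SymmetrisedStepJets (SymTables)
open Summit.QuantumFields.BalabanUV.Beta.SymAveragingHessianCounts (symLinKerAt symVhKerAt symHessKerAt symVhSAt symHessFFAt)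
open Summit.QuantumFields.BalabanUV.Beta.SymAveragingMixedJetTables (symVh2KerAt symMixKerAt symVh₂SAt symMixFFAt)
open Summit.QuantumFields.BalabanUV.Beta.SymSecondOrderTablesAn1 (symVh₂SAn1)
open Summit.QuantumFields.BalabanUV.Beta.SymTablesOf (tabsOf)
open Summit.QuantumFields.BalabanUV.Beta.CompositeVertexKernelRec (compVhS compVh2S compVhS_sym_one locStencil_compVhS_sym compVhS_sym_translate)
open Summit.QuantumFields.BalabanUV.Beta.CompositeVertexKernelBoundsTwoSym (symVh2KerSymAt compVh2S_symSym_one locStencil₂_compVh2S_symSym compVh2S_symSym_translate)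
open Summit.QuantumFields.BalabanUV.Beta.CompositeHessianTable (compHessFF compHessFF_sym_one compHessFF_sym_hH compHessFF_sym_translate)
open Summit.QuantumFields.BalabanUV.Beta.CompositeMixedTable (compMixFF compMixFF_sym_one compMixFF_sym_hmix compMixFF_sym_translate)
open Summit.QuantumFields.BalabanUV.Beta.CompositeCorrectorKernel (psiK spr_psiK shiftK_neg_psiK)
open Summit.QuantumFields.BalabanUV.Beta.CompositeCorrectorDress (compChart)
open Summit.QuantumFields.BalabanUV.Beta.ChartStepJets (JsChart0Of JsChart0Of_S JsChart0Of_W SchartOf WchartOf)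

variable {d : ℕ}

/-! ## §1 The five composite (0.4)-symmetrised tables at blocking `L^m` and the record `tabsComp` -/

section Tables

variable (r : Fin (d + 1) → ℕ) (L m : ℕ)

/-- [our object — bookkeeping] the composite BORDER table (sym bricks): F3's `compVhS` at `(symLinKerAt, symVhKerAt) (toSite r) L`. -/
def compV : Fin (d + 1) → Site (d + 1) → MKer (d + 1) (Fib d) :=
  compVhS (fun _ => symLinKerAt (toSite r) L) (fun _ => symVhKerAt (toSite r) L) L m

/-- [our object — bookkeeping] the composite CONSTRAINT HESSIAN table (sym bricks): F6a's `compHessFF`. -/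
def compH : Fin (d + 1) → Site (d + 1) → MKer (d + 1) (Fib d) :=
  compHessFF (fun _ => symLinKerAt (toSite r) L) (fun _ => symHessKerAt (toSite r) L) L m

/-- [our object — bookkeeping] the composite ROW BORDER table (sym bricks, second brick symmetrised — Q-leaf02-g30-1 (P)), packed ANTI-TWIN as the record's `symVh₂SAn1`. -/
def compB : Fin (d + 1) → Site (d + 1) → Fin (d + 1) → Site (d + 1) → MKer (d + 1) (Fib d) :=
  fun κ u κ' u' => atw (compVh2S (fun _ => symLinKerAt (toSite r) L) (fun _ => symVhKerAt (toSite r) L) (fun _ => symVh2KerSymAt (toSite r) L) L m κ u κ' u')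

/-- [our object — bookkeeping] the composite MIXED table (sym bricks): F6c's `compMixFF`. -/
def compMix : Fin (d + 1) → Site (d + 1) → Fin (d + 1) → Site (d + 1) → MKer (d + 1) (Fib d) :=
  compMixFF (fun _ => symLinKerAt (toSite r) L) (fun _ => symVhKerAt (toSite r) L) (fun _ => symHessKerAt (toSite r) L)
    (fun _ => symMixKerAt (toSite r) L) L m

variable {r L} (hL : 1 ≤ L) (hr : r ∈ box (d + 1) L)
include hL hr

/-- [folklore] (LV) every rate. -/
theorem compV_hV : ∀ δ : ℝ, 0 ≤ δ → ∃ C : ℝ, LocStencil (compV r L m) C δ :=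
  fun _ hδ => ⟨_, locStencil_compVhS_sym hL hr m hδ⟩

/-- [folklore] (LH) every rate, at blocking `L^m`. -/
theorem compH_hH : ∀ δ : ℝ, 0 ≤ δ → ∃ C : ℝ, VertexFamily (compH r L m) (L ^ m) C δ :=
  compHessFF_sym_hH hL hr m

/-- [folklore] (LB): the anti-twin packed composite row border table is a `LocStencil₂` family (F5c §4 at rate `1`, then `biLoc_atw`). -/
theorem compB_hB : ∃ C δ : ℝ, 0 < δ ∧ LocStencil₂ (compB r L m) C δ :=
  ⟨_, 1, one_pos, fun κ u κ' u' =>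
    biLoc_atw (locStencil₂_compVh2S_symSym hL hr m zero_le_one κ u κ' u')
      ((locStencil₂_compVh2S_symSym hL hr m zero_le_one κ u κ' u').nonneg (Sum.inl 0))⟩

/-- [folklore] (Lmix) at blocking `L^m`. -/
theorem compMix_hmix : ∃ C δ : ℝ, 0 < δ ∧ LocStencilFM (L ^ m) (compMix r L m) C δ :=
  compMixFF_sym_hmix hL hr m

omit hr in
/-- [folklore] (TV) at blocking `L^m`. -/
theorem compV_hVt : ∀ (κ : Fin (d + 1)) (u t : Site (d + 1)),
    compV r L m κ (u + ((L ^ m : ℕ) : ℤ) • t) = shiftK (-(((L ^ m : ℕ) : ℤ) • t)) (compV r L m κ u) :=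
  fun κ u t => compVhS_sym_translate hL m κ u t

omit hL hr in
/-- [folklore] (TH) at blocking `L^m`. -/
theorem compH_hHt : ∀ (μ : Fin (d + 1)) (y t : Site (d + 1)),
    compH r L m μ (y + t) = shiftK (-(((L ^ m : ℕ) : ℤ) • t)) (compH r L m μ y) :=
  fun μ y t => compHessFF_sym_translate m μ y t

omit hr in
/-- [folklore] (TB) at blocking `L^m` (F5c §4 (TB) + `atw_shiftK`). -/
theorem compB_hBt : ∀ (κ : Fin (d + 1)) (u : Site (d + 1)) (κ' : Fin (d + 1)) (u' t : Site (d + 1)),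
    compB r L m κ (u + ((L ^ m : ℕ) : ℤ) • t) κ' (u' + ((L ^ m : ℕ) : ℤ) • t) = shiftK (-(((L ^ m : ℕ) : ℤ) • t)) (compB r L m κ u κ' u') := by
  intro κ u κ' u' t
  show atw _ = shiftK _ (atw _)
  rw [compVh2S_symSym_translate hL m κ u κ' u' t, atw_shiftK]

omit hL hr in
/-- [folklore] (Tmix) at blocking `L^m`. -/
theorem compMix_hmixt : ∀ (κ : Fin (d + 1)) (u : Site (d + 1)) (μ : Fin (d + 1)) (w t : Site (d + 1)),
    compMix r L m κ (u + ((L ^ m : ℕ) : ℤ) • t) μ (w + t) = shiftK (-(((L ^ m : ℕ) : ℤ) • t)) (compMix r L m κ u μ w) :=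
  fun κ u μ w t => compMixFF_sym_translate m κ u μ w t

/-- [our object — bookkeeping] **THE COMPOSITE TABLE RECORD AT DEPTH `m`** (blocking `L^m`, one root `r`): F6b's `tabsOf` over the five composite sym tables and their eight letters;
the multiplier family `cM` a free scale-indexed scalar (the record's is `cΛ·wM1`). -/
def tabsComp (cM : ℕ → ℝ) : SymTables d (L ^ m) :=
  tabsOf (L ^ m) (compV r L m) (compH r L m) cM (compB r L m) (compMix r L m)
    (compV_hV m hL hr) (compH_hH m hL hr) (compB_hB m hL hr) (compMix_hmix m hL hr)
    (compV_hVt m hL) (compH_hHt m) (compB_hBt m hL) (compMix_hmixt m)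

/-- [folklore] the record's five tables (`rfl`). -/
theorem tabsComp_V (cM : ℕ → ℝ) : (tabsComp m hL hr cM).V = compV r L m := rfl

/-- [folklore] (`rfl`). -/
theorem tabsComp_H (cM : ℕ → ℝ) : (tabsComp m hL hr cM).H = compH r L m := rfl

/-- [folklore] (`rfl`). -/
theorem tabsComp_vh₂S (cM : ℕ → ℝ) : (tabsComp m hL hr cM).vh₂S = compB r L m := rfl

/-- [folklore] (`rfl`). -/
theorem tabsComp_mixFF (cM : ℕ → ℝ) : (tabsComp m hL hr cM).mixFF = compMix r L m := rfl

omit hL in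
/-- [folklore] ANCHOR (V): at depth one the composite border table IS the record's `symVhSAt (toSite r) d L` (F3b's `compVhS_sym_one`). -/
theorem compV_one : compV r L 1 = symVhSAt (toSite r) d L rfl := compVhS_sym_one hr

omit hL in
/-- [folklore] ANCHOR (H): at depth one the composite Hessian table IS `symHessFFAt (toSite r) L` (F6a's `compHessFF_sym_one`). -/
theorem compH_one : compH r L 1 = symHessFFAt (toSite r) L := compHessFF_sym_one hr

omit hL in
/-- [folklore] ANCHOR (B): at depth one the anti-twin packed composite row border table IS `atw (½ • (symVh₂SAt + swap))` (F5c §4's `compVh2S_symSym_one`). -/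
theorem compB_one (κ : Fin (d + 1)) (u : Site (d + 1)) (κ' : Fin (d + 1)) (u' : Site (d + 1)) :
    compB r L 1 κ u κ' u' = atw ((1 / 2 : ℝ) • (symVh₂SAt (toSite r) L κ u κ' u' + symVh₂SAt (toSite r) L κ' u' κ u)) := by
  show atw _ = atw _
  rw [compVh2S_symSym_one hr]

omit hL hr in
/-- [folklore] **ANCHOR (B) AT THE CENTRED ROOT: the depth-one composite row border table IS THE (0.4) RECORD's `symVh₂SAn1 d L`** (`ctr = toSite ∘ ctrOff`, `rfl`). -/
theorem compB_ctrOff_one (hL : 1 ≤ L) : compB (ctrOff (d + 1) L) L 1 = symVh₂SAn1 d L := by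
  funext κ u κ' u'
  rw [compB_one (ctrOff_mem_box (d := d + 1) hL)]
  rfl

omit hL in
/-- [folklore] ANCHOR (mix): at depth one the composite mixed table IS `symMixFFAt (toSite r) L` (F6c-2 §4's `compMixFF_sym_one`). -/
theorem compMix_one : compMix r L 1 = symMixFFAt (toSite r) L := compMixFF_sym_one hr

end Tables

/-! ## §2 The composite chart as a constant family and the raw composite one-shot jets -/

section Jets

variable {L : ℕ} (hL : 1 ≤ L) {rc : ℕ → (Fin (d + 1) → ℕ)} (hrc : ∀ k, rc k ∈ box (d + 1) L) (m : ℕ)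
  {s : Fin (d + 1) → ℕ} (hs : s ∈ box (d + 1) (L ^ m)) [NeZero (L ^ m)]
include hL hrc hs

/-- [folklore] the composite chart DECAYS (K-U3d's `spr_psiK`, an2's `spr_coDressKBmAt`, `decays_KInv` — `CompositeOneShotChart.spr_compositeA`'s proof at F6e's `compChart`). -/
theorem decays_compChart : ∃ δ C : ℝ, 0 < δ ∧ 0 ≤ C ∧ Decays (compChart rc L m s (L ^ m)) C δ := by
  have hKs : Spr (KInv (N := L ^ m) (d := d)) := by
    obtain ⟨δ, C, hδ, -, h⟩ := decays_KInv (N := L ^ m) (d := d)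
    exact ⟨C, δ, hδ, h⟩
  have hΨ := spr_psiK (lt_of_lt_of_le Nat.zero_lt_one hL) hrc m
  obtain ⟨C, δ, hδ, h⟩ := spr_comp (spr_comp hΨ (spr_coDressKBmAt (one_le_of_neZero (L ^ m)) hs hKs)) hΨ.trK
  exact ⟨δ, C, hδ, h.nonneg (Sum.inl 0), h⟩

omit hrc hs in
/-- [folklore] the composite chart is `L^m`-block covariant (`shiftK_psiK`, `shiftK_coDressKBmAt`, `shiftK_KInv` — `CompositeOneShotChart.shiftK_compositeA`'s proof). -/
theorem shiftK_compChart (t : Site (d + 1)) :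
    shiftK (-(((L ^ m : ℕ) : ℤ) • t)) (compChart rc L m s (L ^ m)) = compChart rc L m s (L ^ m) := by
  have hG := shiftK_coDressKBmAt (toSite s) (one_le_of_neZero (L ^ m)) (K := KInv (N := L ^ m) (d := d))
    (fun t' => shiftK_KInv (N := L ^ m) t') t
  unfold compChart
  rw [← comp_shiftK, ← comp_shiftK, ← trK_shiftK, shiftK_neg_psiK hL rc m t, hG]

/-- [our object — bookkeeping] **THE RAW COMPOSITE ONE-SHOT JETS AT DEPTH `m`** (SPEC S-an2-g52-1 §1): the (III′)-shaped literal's LEVEL-0 member AT BLOCKING `L^m` AT THE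
CONSTANT CHART FAMILY `fun _ => compChart rc L m s (L^m)` over `tabsComp r L m cM` — F6d-1a's `JsChart0Of … 0`.  Pins `cE cVH cΛ cE₂ cB T` are parameters (PIN P-F6-2). -/
def JN {r : Fin (d + 1) → ℕ} (hr : r ∈ box (d + 1) L) (cM : ℕ → ℝ) (cE cVH cΛ cE₂ cB : ℝ) (T : Fin 4 → Fin 4 → Fin 4 → Fin 4 → ℝ) :
    JetData d (L ^ m) :=
  JsChart0Of (fun _ => compChart rc L m s (L ^ m)) (fun _ => decays_compChart hL hrc m hs) (tabsComp m hL hr cM) cE cVH cΛ cE₂ cB T 0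

/-- [folklore] the first-order family of the raw composite jets: `SchartOf … 0 = S0NOf d (L^m) (compV) (compH) cE cVH cΛ` (the Λ word's kernel = `KInv (L^m)`, Q-an2-g52-1 (a)). -/
theorem JN_S {r : Fin (d + 1) → ℕ} (hr : r ∈ box (d + 1) L) (cM : ℕ → ℝ) (cE cVH cΛ cE₂ cB : ℝ) (T : Fin 4 → Fin 4 → Fin 4 → Fin 4 → ℝ) :
    (JN hL hrc m hs hr cM cE cVH cΛ cE₂ cB T).S = SchartOf (fun _ => compChart rc L m s (L ^ m)) (tabsComp m hL hr cM) cE cVH cΛ 0 := rfl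

/-- [folklore] the second-order family: `WchartOf (fun _ => compChart …) (tabsComp …) … 0` (`W2SymOfK` at the composite chart). -/
theorem JN_W {r : Fin (d + 1) → ℕ} (hr : r ∈ box (d + 1) L) (cM : ℕ → ℝ) (cE cVH cΛ cE₂ cB : ℝ) (T : Fin 4 → Fin 4 → Fin 4 → Fin 4 → ℝ) :
    (JN hL hrc m hs hr cM cE cVH cΛ cE₂ cB T).W = WchartOf (fun _ => compChart rc L m s (L ^ m)) (tabsComp m hL hr cM) cE cVH cΛ cE₂ cB T 0 := rfl

end Jets

end Summit.QuantumFields.BalabanUV.Beta.CompositeOneShotJets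

end
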